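import Mathlib
import HarnessLib
import Summits.Ventures.LatticeQCDFlow.Exactness.SUNResidualTangentOperator

/-!
# Derivatives of the tangential block of the `SU(N)` residual isotopy: joint smoothness, the link derivative along one link, and the exchange identity

HONEST FRAMING: exact (Metropolis-corrected) sampling algorithms for lattice gauge theory;
figures of merit are autocorrelation/cost numbers at stated couplings and volumes; no
continuum-physics claim.

Venture `LatticeQCDFlow` (cell pub-lqcd), topic `Exactness`; FANOUT row 10 (`eng-equiv`: `equiv/residual.py`,
`flows_jax/residual_flow.py` — residual / stout / stout-defect layers and their closed-form per-link log-det).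
NEW WORK of the cell; no definition (local notations only); nothing cited as a fact.  Series "the residual
layer's exact Jacobian IS the closed form" (8 files: `SUNJacobianTraceAlgebra`, `SUNResidualTangentDerivative`,
`SUNResidualTangentTimeDerivative`, `SUNResidualGeneratorDivergence`, `SUNResidualJacobiTrace`,
`SUNResidualJacobiIdentity`, `SUNResidualJacobiFlow`, `SUNResidualLayerJacobianDet`), continuing gen-11's
`SUNResidualLayerVelocity` … `SUNResidualLayerJacobian` (existence of a continuous positive exact Jacobian).

File 2 of the series; local notations `famb[τ]`, `Blk[τ, W, a]`, `Top[τ, W, a]` as in `SUNResidualTangentOperator`.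
* `contDiff_residualTangentBlock_apply(_right)`, `contDiff_residualTangentOp_apply(_right)` — `(τ, W) ↦ Blk Y`,
  `Top Y` are jointly `C¹`; `fderiv_fderiv_residualIsotopy_symm` — symmetric second derivative of the isotopy;
* **`fderiv_residualTangentBlock_apply_single`** — `∂_{single a (V W_a)} (Blk · Y)` by the product rule;
* `residualTangentBlock_mul_eq/_skew`, `suProj_residualTangentBlock`, `residualTangentOp_apply_of_skew`
  (`Top X = Blk X` on `𝔰𝔲(n)` at `SU(n)^E` configurations), `residualTangentOp_suProj_comm`;
* **`fderiv_residualTangentBlock_exchange`** — at an `SU(n)^E` configuration, active link `a`, `X, W ∈ 𝔰𝔲(n)`: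
  `∂_{single a (W U_a)}(Blk·X) − ∂_{single a (X U_a)}(Blk·W) = Blk (XW − WX) − [Blk X, Blk W]`.

Printed counterparts, NAMED ONLY: Lüscher, CMP 293 (2010) 899, §3 eqs. (3.4)–(3.9); Abbott et al.,
arXiv:2305.02402 §4.2; Morningstar–Peardon, PRD 69 (2004) 054501; Abel–Jacobi–Liouville (tree:
`Literature.Analysis.ODE.LiouvilleFormula`).
-/

noncomputable section

namespace Summit.Ventures.LatticeQCDFlow.Exactness

open Literature.MathematicalPhysics.QuantumFieldTheory
open Literature.MathematicalPhysics.QuantumFieldTheory.Luscher2010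
open Literature.MathematicalPhysics.QuantumFieldTheory.WilsonFlow
open Filter Set
open scoped Matrix Matrix.Norms.Frobenius Topology ContDiff

variable {d L n : ℕ} [NeZero L]

section Symmetry

variable (p : Edge d L → Prop) [DecidablePred p]
  (Q : {e : Edge d L // p e} → ({f : Edge d L // ¬p f} → Matrix.specialUnitaryGroup (Fin n) ℂ) →
    Matrix (Fin n) (Fin n) ℂ → Matrix (Fin n) (Fin n) ℂ)
  (κ : {e : Edge d L // p e} → ({f : Edge d L // ¬p f} → Matrix.specialUnitaryGroup (Fin n) ℂ) → ℝ)
  (Qamb : {e : Edge d L // p e} → AmbConfig d L n → Matrix (Fin n) (Fin n) ℂ)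

set_option quotPrecheck false in
/-- The residual isotopy at time `τ` (local notation, as in `SUNResidualIsotopy`). -/
local notation "famb[" τ "]" => (fun (W : AmbConfig d L n) (e : Edge d L) =>
  if h : p e then NormedSpace.exp ((τ : ℝ) • Qamb ⟨e, h⟩ W) * W e else W e)

set_option quotPrecheck false in
/-- The block of the tangential operator (local notation, as in `SUNResidualTangentOperator`). -/
local notation "Blk[" τ ", " W ", " a "]" =>
  ((fderiv ℝ (fun Y : Matrix (Fin n) (Fin n) ℂ => Y * ((famb[τ]) W a)ᴴ) 0).comp
    ((fderiv ℝ (fun W' : AmbConfig d L n => W' a) 0).comp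
      ((fderiv ℝ (famb[τ]) W).comp
        ((fderiv ℝ (fun Y : Matrix (Fin n) (Fin n) ℂ => (Pi.single a Y : AmbConfig d L n)) 0).comp
          (fderiv ℝ (fun Y : Matrix (Fin n) (Fin n) ℂ => Y * W a) 0)))))

set_option quotPrecheck false in
/-- The tangential operator (local notation, as in `SUNResidualTangentOperator`). -/
local notation "Top[" τ ", " W ", " a "]" =>
  ((fderiv ℝ (suProj (n := n)) 0).comp ((Blk[τ, W, a]).comp (fderiv ℝ (suProj (n := n)) 0)) +
    (ContinuousLinearMap.id ℝ (Matrix (Fin n) (Fin n) ℂ) - fderiv ℝ (suProj (n := n)) 0))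

/-! ## Joint smoothness of the block and of the tangential operator, applied to a vector -/

/-- **`(τ, W) ↦ Blk[τ, W, a] Y` is jointly `C¹`** for `C²` ambient exponents (operator-valued
calculus done inside the proof; the statement is vector-valued). -/
theorem contDiff_residualTangentBlock_apply (hQ2 : ∀ a, ContDiff ℝ 2 (Qamb a)) (a : Edge d L)
    (Y : Matrix (Fin n) (Fin n) ℂ) :
    ContDiff ℝ 1 (fun q : ℝ × AmbConfig d L n => (Blk[q.1, q.2, a]) Y) := by
  letI i1 : NormedAddCommGroup (Matrix (Fin n) (Fin n) ℂ →L[ℝ] Matrix (Fin n) (Fin n) ℂ) :=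
    ContinuousLinearMap.toNormedAddCommGroup
  letI i2 : NormedSpace ℝ (Matrix (Fin n) (Fin n) ℂ →L[ℝ] Matrix (Fin n) (Fin n) ℂ) :=
    ContinuousLinearMap.toNormedSpace
  letI i3 : NormedAddCommGroup (AmbConfig d L n →L[ℝ] AmbConfig d L n) :=
    ContinuousLinearMap.toNormedAddCommGroup
  letI i4 : NormedSpace ℝ (AmbConfig d L n →L[ℝ] AmbConfig d L n) := ContinuousLinearMap.toNormedSpace
  letI i5 : NormedAddCommGroup (AmbConfig d L n →L[ℝ] Matrix (Fin n) (Fin n) ℂ) :=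
    ContinuousLinearMap.toNormedAddCommGroup
  letI i6 : NormedSpace ℝ (AmbConfig d L n →L[ℝ] Matrix (Fin n) (Fin n) ℂ) :=
    ContinuousLinearMap.toNormedSpace
  letI i7 : NormedAddCommGroup (Matrix (Fin n) (Fin n) ℂ →L[ℝ] AmbConfig d L n) :=
    ContinuousLinearMap.toNormedAddCommGroup
  letI i8 : NormedSpace ℝ (Matrix (Fin n) (Fin n) ℂ →L[ℝ] AmbConfig d L n) :=
    ContinuousLinearMap.toNormedSpace
  have hF2 : ContDiff ℝ 2 (fun q : ℝ × AmbConfig d L n => (famb[q.1]) q.2) :=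
    contDiff_residualIsotopy p Qamb hQ2
  have hD : ContDiff ℝ 1 (fun q : ℝ × AmbConfig d L n => fderiv ℝ (famb[q.1]) q.2) := by
    have hunc : ContDiff ℝ 2 (Function.uncurry fun (q : ℝ × AmbConfig d L n) (W : AmbConfig d L n) =>
        (famb[q.1]) W) := by
      have h1 : (Function.uncurry fun (q : ℝ × AmbConfig d L n) (W : AmbConfig d L n) => (famb[q.1]) W) =
          (fun r : ℝ × AmbConfig d L n => (famb[r.1]) r.2) ∘
            (fun z : (ℝ × AmbConfig d L n) × AmbConfig d L n => (z.1.1, z.2)) := by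
        funext z
        rfl
      rw [h1]
      exact hF2.comp ((contDiff_fst.comp contDiff_fst).prodMk contDiff_snd)
    exact hunc.fderiv contDiff_snd (by norm_num)
  have hm : ContDiff ℝ 2 (fun q : ℝ × AmbConfig d L n => ((famb[q.1]) q.2 a)ᴴ) :=
    contDiff_conjTranspose.comp ((contDiff_eval a).comp hF2)
  have hR : ContDiff ℝ 1 (fun q : ℝ × AmbConfig d L n =>
      fderiv ℝ (fun Y : Matrix (Fin n) (Fin n) ℂ => Y * ((famb[q.1]) q.2 a)ᴴ) 0) := by
    have hunc : ContDiff ℝ 2 (Function.uncurry fun (q : ℝ × AmbConfig d L n)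
        (Y : Matrix (Fin n) (Fin n) ℂ) => Y * ((famb[q.1]) q.2 a)ᴴ) :=
      contDiff_snd.mul (hm.comp contDiff_fst)
    exact hunc.fderiv contDiff_const (by norm_num)
  have hRW : ContDiff ℝ 1 (fun q : ℝ × AmbConfig d L n =>
      fderiv ℝ (fun Y : Matrix (Fin n) (Fin n) ℂ => Y * q.2 a) 0) := by
    have hunc : ContDiff ℝ 2 (Function.uncurry fun (q : ℝ × AmbConfig d L n)
        (Y : Matrix (Fin n) (Fin n) ℂ) => Y * q.2 a) :=
      contDiff_snd.mul (((contDiff_eval a).comp contDiff_snd).comp contDiff_fst)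
    exact hunc.fderiv contDiff_const (by norm_num)
  have hBlk : ContDiff ℝ 1 (fun q : ℝ × AmbConfig d L n => Blk[q.1, q.2, a]) :=
    hR.clm_comp (contDiff_const.clm_comp (hD.clm_comp (contDiff_const.clm_comp hRW)))
  exact hBlk.clm_apply contDiff_const

/-- **`(τ, W) ↦ Top[τ, W, a] Y` is jointly `C¹`.** -/
theorem contDiff_residualTangentOp_apply (hQ2 : ∀ a, ContDiff ℝ 2 (Qamb a)) (a : Edge d L)
    (Y : Matrix (Fin n) (Fin n) ℂ) :
    ContDiff ℝ 1 (fun q : ℝ × AmbConfig d L n => (Top[q.1, q.2, a]) Y) := by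
  have h := contDiff_residualTangentBlock_apply p Qamb hQ2 a (suProj Y)
  have heq : (fun q : ℝ × AmbConfig d L n => (Top[q.1, q.2, a]) Y) =
      fun q => suProj ((Blk[q.1, q.2, a]) (suProj Y)) + (Y - suProj Y) := by
    funext q
    change fderiv ℝ (suProj (n := n)) 0 ((Blk[q.1, q.2, a]) (fderiv ℝ (suProj (n := n)) 0 Y)) +
      (Y - fderiv ℝ (suProj (n := n)) 0 Y) = _
    rw [fderiv_suProj_apply, fderiv_suProj_apply]
  rw [heq]
  exact ((contDiff_suProj (m := 1)).comp h).add contDiff_const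

/-- Fixed-time corollary: `W ↦ Blk[τ, W, a] Y` is `C¹`. -/
theorem contDiff_residualTangentBlock_apply_right (hQ2 : ∀ a, ContDiff ℝ 2 (Qamb a)) (τ : ℝ)
    (a : Edge d L) (Y : Matrix (Fin n) (Fin n) ℂ) :
    ContDiff ℝ 1 (fun W : AmbConfig d L n => (Blk[τ, W, a]) Y) := by
  have h := (contDiff_residualTangentBlock_apply p Qamb hQ2 a Y).comp
    ((contDiff_const (c := τ)).prodMk (contDiff_id (E := AmbConfig d L n)))
  exact h

/-- Fixed-time corollary: `W ↦ Top[τ, W, a] Y` is `C¹`. -/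
theorem contDiff_residualTangentOp_apply_right (hQ2 : ∀ a, ContDiff ℝ 2 (Qamb a)) (τ : ℝ)
    (a : Edge d L) (Y : Matrix (Fin n) (Fin n) ℂ) :
    ContDiff ℝ 1 (fun W : AmbConfig d L n => (Top[τ, W, a]) Y) := by
  have h := (contDiff_residualTangentOp_apply p Qamb hQ2 a Y).comp
    ((contDiff_const (c := τ)).prodMk (contDiff_id (E := AmbConfig d L n)))
  exact h

/-! ## Second derivatives of the isotopy -/

/-- **Symmetry of the second derivative of the isotopy** (vector form): for the `C²` map
`famb[τ]`, `∂_h (D famb[τ] · k) = ∂_k (D famb[τ] · h)`. -/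
theorem fderiv_fderiv_residualIsotopy_symm (hQ2 : ∀ a, ContDiff ℝ 2 (Qamb a)) (τ : ℝ)
    (W₀ h k : AmbConfig d L n) :
    fderiv ℝ (fun W' : AmbConfig d L n => fderiv ℝ (famb[τ]) W' k) W₀ h =
      fderiv ℝ (fun W' : AmbConfig d L n => fderiv ℝ (famb[τ]) W' h) W₀ k := by
  letI i3 : NormedAddCommGroup (AmbConfig d L n →L[ℝ] AmbConfig d L n) :=
    ContinuousLinearMap.toNormedAddCommGroup
  letI i4 : NormedSpace ℝ (AmbConfig d L n →L[ℝ] AmbConfig d L n) := ContinuousLinearMap.toNormedSpace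
  have hF : ContDiff ℝ 2 (famb[τ]) := contDiff_residualIsotopy_right p Qamb hQ2 τ
  have hc : ContDiff ℝ 1 (fderiv ℝ (famb[τ])) := hF.fderiv_right (by norm_num)
  have hcd : HasFDerivAt (fderiv ℝ (famb[τ])) (fderiv ℝ (fderiv ℝ (famb[τ])) W₀) W₀ :=
    ((hc.differentiable (by norm_num)).differentiableAt).hasFDerivAt
  have happ : ∀ v w : AmbConfig d L n, fderiv ℝ (fun W' : AmbConfig d L n => fderiv ℝ (famb[τ]) W' v) W₀ w =
      fderiv ℝ (fderiv ℝ (famb[τ])) W₀ w v := by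
    intro v w
    have h1 : HasFDerivAt (fun W' : AmbConfig d L n => fderiv ℝ (famb[τ]) W' v)
        ((ContinuousLinearMap.apply ℝ (AmbConfig d L n) v).comp (fderiv ℝ (fderiv ℝ (famb[τ])) W₀)) W₀ :=
      (ContinuousLinearMap.apply ℝ (AmbConfig d L n) v).hasFDerivAt.comp W₀ hcd
    have h2 : fderiv ℝ (fun W' : AmbConfig d L n => fderiv ℝ (famb[τ]) W' v) W₀ =
        (ContinuousLinearMap.apply ℝ (AmbConfig d L n) v).comp (fderiv ℝ (fderiv ℝ (famb[τ])) W₀) := h1.fderiv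
    have h3 := congrArg (fun T : AmbConfig d L n →L[ℝ] AmbConfig d L n => T w) h2
    exact h3
  have hsymm : IsSymmSndFDerivAt ℝ (famb[τ]) W₀ := hF.contDiffAt.isSymmSndFDerivAt (by simp)
  rw [happ, happ]
  exact hsymm h k

/-- **Directional derivative of the block along one link.**  For every ambient `W₀`, every
link `a` and all matrices `Y`, `V`: the derivative of `W' ↦ Blk[τ, W', a] Y` at `W₀` in the
direction `single a (V W₀_a)` is
`((D famb·single a (Y V W₀_a))_a + (∂_{single a (V W₀_a)} (D famb · single a (Y W₀_a)))_a) (famb W₀ a)ᴴ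
 + (D famb·single a (Y W₀_a))_a ((D famb·single a (V W₀_a))_a)ᴴ`
(product rule along the curve `r ↦ W₀[a ↦ e^{rV} W₀_a]`). -/
theorem fderiv_residualTangentBlock_apply_single (hQ2 : ∀ a, ContDiff ℝ 2 (Qamb a)) (τ : ℝ)
    (W₀ : AmbConfig d L n) (a : Edge d L) (Y V : Matrix (Fin n) (Fin n) ℂ) :
    fderiv ℝ (fun W' : AmbConfig d L n => (Blk[τ, W', a]) Y) W₀ (Pi.single a (V * W₀ a)) =
      ((fderiv ℝ (fun W' : AmbConfig d L n => fderiv ℝ (famb[τ]) W' (Pi.single a (Y * W₀ a))) W₀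
            (Pi.single a (V * W₀ a))) a
        + (fderiv ℝ (famb[τ]) W₀ (Pi.single a (Y * (V * W₀ a)))) a) * ((famb[τ]) W₀ a)ᴴ
      + (fderiv ℝ (famb[τ]) W₀ (Pi.single a (Y * W₀ a))) a *
          ((fderiv ℝ (famb[τ]) W₀ (Pi.single a (V * W₀ a))) a)ᴴ := by
  letI i3 : NormedAddCommGroup (AmbConfig d L n →L[ℝ] AmbConfig d L n) :=
    ContinuousLinearMap.toNormedAddCommGroup
  letI i4 : NormedSpace ℝ (AmbConfig d L n →L[ℝ] AmbConfig d L n) := ContinuousLinearMap.toNormedSpace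
  have hF : ContDiff ℝ 2 (famb[τ]) := contDiff_residualIsotopy_right p Qamb hQ2 τ
  have hc : ContDiff ℝ 1 (fderiv ℝ (famb[τ])) := hF.fderiv_right (by norm_num)
  have hcd : HasFDerivAt (fderiv ℝ (famb[τ])) (fderiv ℝ (fderiv ℝ (famb[τ])) W₀) W₀ :=
    ((hc.differentiable (by norm_num)).differentiableAt).hasFDerivAt
  -- the curve and its velocity
  set γ : ℝ → AmbConfig d L n := fun r => Function.update W₀ a (NormedSpace.exp (r • V) * W₀ a) with hγ
  have hγ0 : γ 0 = W₀ := by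
    simp only [hγ, zero_smul, NormedSpace.exp_zero, one_mul, Function.update_eq_self]
  have hγd : HasDerivAt γ (Pi.single a (V * W₀ a)) 0 := hasDerivAt_update_exp_smul W₀ a V
  have hγa : ∀ r, γ r a = NormedSpace.exp (r • V) * W₀ a := fun r => by
    simp only [hγ, Function.update_self]
  have hg : DifferentiableAt ℝ (fun W' : AmbConfig d L n => (Blk[τ, W', a]) Y) W₀ :=
    ((contDiff_residualTangentBlock_apply_right p Qamb hQ2 τ a Y).differentiable (by norm_num)).differentiableAt
  have hcomp : HasDerivAt (fun r => (Blk[τ, γ r, a]) Y)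
      (fderiv ℝ (fun W' : AmbConfig d L n => (Blk[τ, W', a]) Y) W₀ (Pi.single a (V * W₀ a))) 0 :=
    hg.hasFDerivAt.comp_hasDerivAt_of_eq (0 : ℝ) hγd hγ0.symm
  have hfun : (fun r => (Blk[τ, γ r, a]) Y) = fun r =>
      (fderiv ℝ (famb[τ]) (γ r) (Pi.single a (Y * (NormedSpace.exp (r • V) * W₀ a)))) a *
        star ((famb[τ]) (γ r) a) := by
    funext r
    rw [residualTangentBlock_apply, hγa, Matrix.star_eq_conjTranspose]
  have hA : HasDerivAt (fun r => fderiv ℝ (famb[τ]) (γ r))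
      (fderiv ℝ (fderiv ℝ (famb[τ])) W₀ (Pi.single a (V * W₀ a))) 0 :=
    hcd.comp_hasDerivAt_of_eq (0 : ℝ) hγd hγ0.symm
  have hu : HasDerivAt (fun r : ℝ => (Pi.single a (Y * (NormedSpace.exp (r • V) * W₀ a)) : AmbConfig d L n))
      (Pi.single a (Y * (V * W₀ a))) 0 := by
    have h1 : HasDerivAt (fun r : ℝ => Y * (NormedSpace.exp (r • V) * W₀ a)) (Y * (V * W₀ a)) 0 :=
      (hasDerivAt_exp_smul_mul (W₀ a) V).const_mul Y
    refine hasDerivAt_pi.2 fun b => ?_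
    rcases eq_or_ne b a with rfl | hb
    · simp only [Pi.single_eq_same]
      exact h1
    · simp only [Pi.single_eq_of_ne hb]
      exact hasDerivAt_const 0 _
  have he : HasDerivAt (fun r => fderiv ℝ (famb[τ]) (γ r)
      (Pi.single a (Y * (NormedSpace.exp (r • V) * W₀ a))))
      (fderiv ℝ (fderiv ℝ (famb[τ])) W₀ (Pi.single a (V * W₀ a))
          (Pi.single a (Y * (NormedSpace.exp ((0 : ℝ) • V) * W₀ a))) +
        fderiv ℝ (famb[τ]) (γ 0) (Pi.single a (Y * (V * W₀ a)))) 0 := hA.clm_apply hu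
  have hea := (hasDerivAt_pi.1 he) a
  have hm : HasDerivAt (fun r => star ((famb[τ]) (γ r) a))
      (star ((fderiv ℝ (famb[τ]) W₀ (Pi.single a (V * W₀ a))) a)) 0 := by
    have h1 := (hasDerivAt_pi.1 (hasDerivAt_residualIsotopy_comp_update p Qamb hQ2 τ W₀ a V)) a
    exact h1.star
  have hprod := hea.mul hm
  rw [hfun] at hcomp
  have huniq := hcomp.unique hprod
  rw [huniq]
  simp only [zero_smul, NormedSpace.exp_zero, one_mul, hγ0, Matrix.star_eq_conjTranspose, Pi.add_apply]
  -- the second-derivative term, read as a vector-valued derivative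
  set k : AmbConfig d L n := Pi.single a (Y * W₀ a) with hk
  have happ : fderiv ℝ (fderiv ℝ (famb[τ])) W₀ (Pi.single a (V * W₀ a)) k =
      fderiv ℝ (fun W' : AmbConfig d L n => fderiv ℝ (famb[τ]) W' k) W₀ (Pi.single a (V * W₀ a)) := by
    have h1 : HasFDerivAt (fun W' : AmbConfig d L n => fderiv ℝ (famb[τ]) W' k)
        ((ContinuousLinearMap.apply ℝ (AmbConfig d L n) k).comp (fderiv ℝ (fderiv ℝ (famb[τ])) W₀)) W₀ :=
      (ContinuousLinearMap.apply ℝ (AmbConfig d L n) k).hasFDerivAt.comp W₀ hcd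
    have h2 : fderiv ℝ (fun W' : AmbConfig d L n => fderiv ℝ (famb[τ]) W' k) W₀ =
        (ContinuousLinearMap.apply ℝ (AmbConfig d L n) k).comp (fderiv ℝ (fderiv ℝ (famb[τ])) W₀) := h1.fderiv
    have h3 := congrArg (fun T : AmbConfig d L n →L[ℝ] AmbConfig d L n => T (Pi.single a (V * W₀ a))) h2
    exact h3.symm
  rw [happ]

/-! ## Values of the block at `SU(n)^E` configurations -/

omit [NeZero L] in
/-- `Blk X · famb_a = (D famb · single a (X U_a))_a` (the last factor of the block is unitary). -/
theorem residualTangentBlock_mul_eq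
    (hQ : ∀ a y, ∀ U ∈ Matrix.specialUnitaryGroup (Fin n) ℂ, (Q a y U)ᴴ = -Q a y U ∧ (Q a y U).trace = 0)
    (hQambQ : ∀ a (U : GaugeConfig d L (Matrix.specialUnitaryGroup (Fin n) ℂ)),
      Qamb a (coeConfig U) = Q a (fun f => U f) (U a.1 : Matrix (Fin n) (Fin n) ℂ))
    (τ : ℝ) (U : GaugeConfig d L (Matrix.specialUnitaryGroup (Fin n) ℂ)) (a : Edge d L)
    (X : Matrix (Fin n) (Fin n) ℂ) :
    (Blk[τ, coeConfig U, a]) X * (famb[τ]) (coeConfig U) a =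
      fderiv ℝ (famb[τ]) (coeConfig U) (Pi.single a (X * (U a : Matrix (Fin n) (Fin n) ℂ))) a := by
  have hfU : ((famb[τ]) (coeConfig U) a)ᴴ * (famb[τ]) (coeConfig U) a = 1 := by
    have hm := residualIsotopy_mem p Q Qamb hQ hQambQ τ U a
    have h := Matrix.mem_unitaryGroup_iff'.mp (Matrix.mem_specialUnitaryGroup_iff.mp hm).1
    simpa only [Matrix.star_eq_conjTranspose] using h
  rw [residualTangentBlock_apply, Matrix.mul_assoc, hfU, Matrix.mul_one, coeConfig_apply]

/-- **The block maps `𝔰𝔲(n)` into `𝔰𝔲(n)`** at `SU(n)^E` configurations (active link). -/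
theorem residualTangentBlock_skew (hQ2 : ∀ a, ContDiff ℝ 2 (Qamb a))
    (hQ : ∀ a y, ∀ U ∈ Matrix.specialUnitaryGroup (Fin n) ℂ, (Q a y U)ᴴ = -Q a y U ∧ (Q a y U).trace = 0)
    (hlip : ∀ a y, ∀ U ∈ Matrix.specialUnitaryGroup (Fin n) ℂ, ∀ V ∈ Matrix.specialUnitaryGroup (Fin n) ℂ,
      frobNorm (Q a y U - Q a y V) ≤ κ a y * frobNorm (U - V))
    (hQambQ : ∀ a (U : GaugeConfig d L (Matrix.specialUnitaryGroup (Fin n) ℂ)),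
      Qamb a (coeConfig U) = Q a (fun f => U f) (U a.1 : Matrix (Fin n) (Fin n) ℂ))
    (τ : ℝ) (U : GaugeConfig d L (Matrix.specialUnitaryGroup (Fin n) ℂ)) {a : Edge d L} (ha : p a)
    {X : Matrix (Fin n) (Fin n) ℂ} (hX : Xᴴ = -X) (hX0 : X.trace = 0) :
    ((Blk[τ, coeConfig U, a]) X)ᴴ = -((Blk[τ, coeConfig U, a]) X) ∧ ((Blk[τ, coeConfig U, a]) X).trace = 0 := by
  have hB : (Blk[τ, coeConfig U, a]) X =
      (fderiv ℝ (famb[τ]) (coeConfig U) (Pi.single a (X * (U a : Matrix (Fin n) (Fin n) ℂ)))) a *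
        (NormedSpace.exp (τ • Qamb ⟨a, ha⟩ (coeConfig U)) * (U a : Matrix (Fin n) (Fin n) ℂ))ᴴ := by
    rw [residualTangentBlock_apply]
    simp only [ha, ↓reduceDIte, coeConfig_apply]
  obtain ⟨h, -⟩ := fderiv_residualIsotopy_single_self p Q κ Qamb hQ2 hQ hlip hQambQ τ U ha hX hX0
  rw [hB]
  exact h

/-- `suProj (Blk X) = Blk X` for `X ∈ 𝔰𝔲(n)` at `SU(n)^E` configurations. -/
theorem suProj_residualTangentBlock (hQ2 : ∀ a, ContDiff ℝ 2 (Qamb a))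
    (hQ : ∀ a y, ∀ U ∈ Matrix.specialUnitaryGroup (Fin n) ℂ, (Q a y U)ᴴ = -Q a y U ∧ (Q a y U).trace = 0)
    (hlip : ∀ a y, ∀ U ∈ Matrix.specialUnitaryGroup (Fin n) ℂ, ∀ V ∈ Matrix.specialUnitaryGroup (Fin n) ℂ,
      frobNorm (Q a y U - Q a y V) ≤ κ a y * frobNorm (U - V))
    (hQambQ : ∀ a (U : GaugeConfig d L (Matrix.specialUnitaryGroup (Fin n) ℂ)),
      Qamb a (coeConfig U) = Q a (fun f => U f) (U a.1 : Matrix (Fin n) (Fin n) ℂ))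
    (τ : ℝ) (U : GaugeConfig d L (Matrix.specialUnitaryGroup (Fin n) ℂ)) {a : Edge d L} (ha : p a)
    {X : Matrix (Fin n) (Fin n) ℂ} (hX : Xᴴ = -X) (hX0 : X.trace = 0) :
    suProj ((Blk[τ, coeConfig U, a]) X) = (Blk[τ, coeConfig U, a]) X := by
  obtain ⟨h1, h2⟩ := residualTangentBlock_skew p Q κ Qamb hQ2 hQ hlip hQambQ τ U ha hX hX0
  exact suProj_eq_self h1 h2

/-- **On `𝔰𝔲(n)` the tangential operator IS the block**: `Top X = Blk X` for `X ∈ 𝔰𝔲(n)` at an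
`SU(n)^E` configuration. -/
theorem residualTangentOp_apply_of_skew (hQ2 : ∀ a, ContDiff ℝ 2 (Qamb a))
    (hQ : ∀ a y, ∀ U ∈ Matrix.specialUnitaryGroup (Fin n) ℂ, (Q a y U)ᴴ = -Q a y U ∧ (Q a y U).trace = 0)
    (hlip : ∀ a y, ∀ U ∈ Matrix.specialUnitaryGroup (Fin n) ℂ, ∀ V ∈ Matrix.specialUnitaryGroup (Fin n) ℂ,
      frobNorm (Q a y U - Q a y V) ≤ κ a y * frobNorm (U - V))
    (hQambQ : ∀ a (U : GaugeConfig d L (Matrix.specialUnitaryGroup (Fin n) ℂ)),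
      Qamb a (coeConfig U) = Q a (fun f => U f) (U a.1 : Matrix (Fin n) (Fin n) ℂ))
    (τ : ℝ) (U : GaugeConfig d L (Matrix.specialUnitaryGroup (Fin n) ℂ)) {a : Edge d L} (ha : p a)
    {X : Matrix (Fin n) (Fin n) ℂ} (hX : Xᴴ = -X) (hX0 : X.trace = 0) :
    (Top[τ, coeConfig U, a]) X = (Blk[τ, coeConfig U, a]) X := by
  rw [residualTangentOp_apply, suProj_eq_self hX hX0, sub_self, add_zero, ← residualTangentBlock_apply]
  exact suProj_residualTangentBlock p Q κ Qamb hQ2 hQ hlip hQambQ τ U ha hX hX0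

omit [NeZero L] in
/-- **`Top` commutes with `𝒫`** (block algebra, every `(τ, W)`). -/
theorem residualTangentOp_suProj_comm (τ : ℝ) (W : AmbConfig d L n) (a : Edge d L)
    (v : Matrix (Fin n) (Fin n) ℂ) :
    (Top[τ, W, a]) (suProj v) = suProj ((Top[τ, W, a]) v) := by
  rw [residualTangentOp_apply, residualTangentOp_apply, suProj_suProj, sub_self, add_zero, suProj_add,
    suProj_suProj, suProj_sub, suProj_suProj, sub_self, add_zero]

/-! ## The symmetry identity -/

/-- **Exchange identity for the block's link derivatives.**  At an `SU(n)^E` configuration, for an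
active link `a` and `X, W ∈ 𝔰𝔲(n)`:
`∂_{single a (W U_a)} (Blk · X) − ∂_{single a (X U_a)} (Blk · W) = Blk (XW − WX) − (Blk X · Blk W − Blk W · Blk X)`
— symmetry of the second derivative of the `C²` isotopy, the product rule, and `Blk X, Blk W ∈ 𝔰𝔲(n)`. -/
theorem fderiv_residualTangentBlock_exchange (hQ2 : ∀ a, ContDiff ℝ 2 (Qamb a))
    (hQ : ∀ a y, ∀ U ∈ Matrix.specialUnitaryGroup (Fin n) ℂ, (Q a y U)ᴴ = -Q a y U ∧ (Q a y U).trace = 0)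
    (hlip : ∀ a y, ∀ U ∈ Matrix.specialUnitaryGroup (Fin n) ℂ, ∀ V ∈ Matrix.specialUnitaryGroup (Fin n) ℂ,
      frobNorm (Q a y U - Q a y V) ≤ κ a y * frobNorm (U - V))
    (hQambQ : ∀ a (U : GaugeConfig d L (Matrix.specialUnitaryGroup (Fin n) ℂ)),
      Qamb a (coeConfig U) = Q a (fun f => U f) (U a.1 : Matrix (Fin n) (Fin n) ℂ))
    (τ : ℝ) (U : GaugeConfig d L (Matrix.specialUnitaryGroup (Fin n) ℂ)) {a : Edge d L} (ha : p a)
    {X W : Matrix (Fin n) (Fin n) ℂ} (hX : Xᴴ = -X) (hX0 : X.trace = 0) (hW : Wᴴ = -W) (hW0 : W.trace = 0) :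
    fderiv ℝ (fun W' : AmbConfig d L n => (Blk[τ, W', a]) X) (coeConfig U)
        (Pi.single a (W * (U a : Matrix (Fin n) (Fin n) ℂ)))
      - fderiv ℝ (fun W' : AmbConfig d L n => (Blk[τ, W', a]) W) (coeConfig U)
        (Pi.single a (X * (U a : Matrix (Fin n) (Fin n) ℂ))) =
      (Blk[τ, coeConfig U, a]) (X * W - W * X)
        - ((Blk[τ, coeConfig U, a]) X * (Blk[τ, coeConfig U, a]) W
          - (Blk[τ, coeConfig U, a]) W * (Blk[τ, coeConfig U, a]) X) := by
  have hUa : (coeConfig U) a = (U a : Matrix (Fin n) (Fin n) ℂ) := coeConfig_apply U a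
  have h1 := fderiv_residualTangentBlock_apply_single p Qamb hQ2 τ (coeConfig U) a X W
  have h2 := fderiv_residualTangentBlock_apply_single p Qamb hQ2 τ (coeConfig U) a W X
  rw [hUa] at h1 h2
  rw [h1, h2]
  rw [fderiv_fderiv_residualIsotopy_symm p Qamb hQ2 τ (coeConfig U)
    (Pi.single a (W * (U a : Matrix (Fin n) (Fin n) ℂ))) (Pi.single a (X * (U a : Matrix (Fin n) (Fin n) ℂ)))]
  set f := (famb[τ]) (coeConfig U) a with hf
  have hBX := residualTangentBlock_mul_eq p Q Qamb hQ hQambQ τ U a X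
  have hBW := residualTangentBlock_mul_eq p Q Qamb hQ hQambQ τ U a W
  have hBXW := residualTangentBlock_mul_eq p Q Qamb hQ hQambQ τ U a (X * W)
  have hBWX := residualTangentBlock_mul_eq p Q Qamb hQ hQambQ τ U a (W * X)
  rw [← hf] at hBX hBW hBXW hBWX
  rw [← Matrix.mul_assoc X W, ← Matrix.mul_assoc W X, ← hBX, ← hBW, ← hBXW, ← hBWX]
  have hfU : f * fᴴ = 1 := by
    have hm := residualIsotopy_mem p Q Qamb hQ hQambQ τ U a
    have h := Matrix.mem_unitaryGroup_iff.mp (Matrix.mem_specialUnitaryGroup_iff.mp hm).1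
    simpa only [Matrix.star_eq_conjTranspose, hf] using h
  obtain ⟨hsX, -⟩ := residualTangentBlock_skew p Q κ Qamb hQ2 hQ hlip hQambQ τ U ha hX hX0
  obtain ⟨hsW, -⟩ := residualTangentBlock_skew p Q κ Qamb hQ2 hQ hlip hQambQ τ U ha hW hW0
  set BX := (Blk[τ, coeConfig U, a]) X with hBXdef
  set BW := (Blk[τ, coeConfig U, a]) W with hBWdef
  set BXW := (Blk[τ, coeConfig U, a]) (X * W) with hBXWdef
  set BWX := (Blk[τ, coeConfig U, a]) (W * X) with hBWXdef
  have hsub : (Blk[τ, coeConfig U, a]) (X * W - W * X) = BXW - BWX := by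
    rw [map_sub]
  rw [hsub, Matrix.conjTranspose_mul, Matrix.conjTranspose_mul, hsX, hsW]
  have e1 : BX * f * (fᴴ * -BW) = -(BX * BW) := by
    rw [Matrix.mul_neg, Matrix.mul_neg, Matrix.mul_assoc BX f, ← Matrix.mul_assoc f fᴴ, hfU, Matrix.one_mul]
  have e2 : BW * f * (fᴴ * -BX) = -(BW * BX) := by
    rw [Matrix.mul_neg, Matrix.mul_neg, Matrix.mul_assoc BW f, ← Matrix.mul_assoc f fᴴ, hfU, Matrix.one_mul]
  have hBXWf : BXW * f * fᴴ = BXW := by rw [Matrix.mul_assoc, hfU, Matrix.mul_one]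
  have hBWXf : BWX * f * fᴴ = BWX := by rw [Matrix.mul_assoc, hfU, Matrix.mul_one]
  rw [Matrix.add_mul, Matrix.add_mul, hBXWf, hBWXf, e1, e2]
  abel

end Symmetry

end Summit.Ventures.LatticeQCDFlow.Exactness

end
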